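import Summits.ValiantsHypothesis.ValiantsHypothesis.Theorems.KPlusLogSqLawStaticPathLowTipsSteps

/-!
# Route «KPlusLogSqLaw» — parametric max-weight independent set on a path: THEOREM T′, the λ-low tips — existence between a sub- and a super-window

HONEST FRAMING.  Helper toward the crux `WeakLifting` (item `stmt-ValiantsHypothesis-19561`, route `KPlusLogSqLaw`, cell `pub-symmetroid`,
seat val-sym-lift-p4 g21, 2026-08-29) on the line of its witness-plan stub `stub_tridiagonalSectorB` (tropical twin of the STATIC tridiagonal
sector = parametric maximum-weight independent set on a path).  Third file of the λ-low-tip geometry of THEOREM T′ (THEOREM-T.md §4): hypothesis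
(B) of the signed counting lemma `…StaticPathSignedTipCount.signed_card_le_of_unique_tips` — **`lowTip_between`**: in general position (pairwise
distinct slopes, none equal to `λ`, no third line through a crossing), if a sub-window `[i, j₁]` and a super-window `[i, j₃]` both have a λ-low tip,
so does `[i, j₂]` for `j₁ ≤ j₂ ≤ j₃`: the λ-type pair of `[i, j₂]` whose vertex has the LARGEST value of `y - λθ` is the tip (every other line of the
window is strictly correct there by `noBad_typeI/II/III` of `…StaticPathLowTipsSteps`, the super-window's tip vertex serving as the weakly-correct
witness).  Also `slope_ne_of_lowType`, `lowType_symm`.  Statements about a labelled line arrangement; nothing here asserts anything about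
`WeakLifting`, `TropicalB`, `KPlusLogSqLaw`, the stub in its window, `MatrixDescartes` (stmt-ValiantsHypothesis-18050) or `VP ≠ VNP`.
-/

set_option linter.dupNamespace false
set_option autoImplicit false

namespace Summit.ValiantsHypothesis.ValiantsHypothesis.Theorems.KPlusLogSqLaw

open Finset Classical

namespace StaticPathFold

noncomputable section

variable (a b : ℕ → ℝ)

section LowTips

variable (lam : ℝ) (S : ℕ → ℕ → Prop)

/-! ## 4. Existence of the λ-low tip between a sub-window and a super-window having one -/

/-- the two lines of a λ-type pair have different slopes. [folklore] -/
theorem slope_ne_of_lowType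
    (hS : ∀ p q, S p q ↔
      ((¬ Even p ∧ ¬ Even q ∧ ((a p < lam ∧ lam < a q) ∨ (a q < lam ∧ lam < a p))) ∨
       (Odd (p + q) ∧ (if Even p then a q < a p else a p < a q) ∧ lam < (if Even p then a q else a p)) ∨
       (Odd (p + q) ∧ (if Even p then a p < a q else a q < a p) ∧ (if Even p then a q else a p) < lam)))
    {u v : ℕ} (h : S u v) : a u ≠ a v := by
  rcases (hS u v).mp h with ⟨-, -, h⟩ | ⟨-, h, -⟩ | ⟨-, h, -⟩
  · rcases h with ⟨h1, h2⟩ | ⟨h1, h2⟩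
    · exact ne_of_lt (h1.trans h2)
    · exact (ne_of_lt (h1.trans h2)).symm
  · split_ifs at h
    · exact (ne_of_lt h).symm
    · exact ne_of_lt h
  · split_ifs at h
    · exact ne_of_lt h
    · exact (ne_of_lt h).symm

/-- the λ-type predicate is symmetric in the pair. [folklore] -/
theorem lowType_symm
    (hS : ∀ p q, S p q ↔
      ((¬ Even p ∧ ¬ Even q ∧ ((a p < lam ∧ lam < a q) ∨ (a q < lam ∧ lam < a p))) ∨
       (Odd (p + q) ∧ (if Even p then a q < a p else a p < a q) ∧ lam < (if Even p then a q else a p)) ∨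
       (Odd (p + q) ∧ (if Even p then a p < a q else a q < a p) ∧ (if Even p then a q else a p) < lam)))
    {u v : ℕ} (h : S u v) : S v u := by
  rw [hS] at h ⊢
  rcases h with ⟨hu, hv, hstr⟩ | ⟨hodd, hs, hl⟩ | ⟨hodd, hs, hl⟩
  · exact Or.inl ⟨hv, hu, hstr.symm⟩
  · right; left
    refine ⟨by rw [add_comm]; exact hodd, ?_, ?_⟩
    · by_cases hue : Even u
      · have hvo : ¬ Even v := fun h => by rw [Nat.odd_add'] at hodd; exact (Nat.not_even_iff_odd.mpr (hodd.mpr hue)) h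
        rw [if_pos hue] at hs; rw [if_neg hvo]; exact hs
      · have hve : Even v := by rw [Nat.odd_add] at hodd; exact hodd.mp (Nat.not_even_iff_odd.mp hue)
        rw [if_neg hue] at hs; rw [if_pos hve]; exact hs
    · by_cases hue : Even u
      · have hvo : ¬ Even v := fun h => by rw [Nat.odd_add'] at hodd; exact (Nat.not_even_iff_odd.mpr (hodd.mpr hue)) h
        rw [if_pos hue] at hl; rw [if_neg hvo]; exact hl
      · have hve : Even v := by rw [Nat.odd_add] at hodd; exact hodd.mp (Nat.not_even_iff_odd.mp hue)
        rw [if_neg hue] at hl; rw [if_pos hve]; exact hl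
  · right; right
    refine ⟨by rw [add_comm]; exact hodd, ?_, ?_⟩
    · by_cases hue : Even u
      · have hvo : ¬ Even v := fun h => by rw [Nat.odd_add'] at hodd; exact (Nat.not_even_iff_odd.mpr (hodd.mpr hue)) h
        rw [if_pos hue] at hs; rw [if_neg hvo]; exact hs
      · have hve : Even v := by rw [Nat.odd_add] at hodd; exact hodd.mp (Nat.not_even_iff_odd.mp hue)
        rw [if_neg hue] at hs; rw [if_pos hve]; exact hs
    · by_cases hue : Even u
      · have hvo : ¬ Even v := fun h => by rw [Nat.odd_add'] at hodd; exact (Nat.not_even_iff_odd.mpr (hodd.mpr hue)) h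
        rw [if_pos hue] at hl; rw [if_neg hvo]; exact hl
      · have hve : Even v := by rw [Nat.odd_add] at hodd; exact hodd.mp (Nat.not_even_iff_odd.mp hue)
        rw [if_neg hue] at hl; rw [if_pos hve]; exact hl

/-- **EXISTENCE OF THE λ-LOW TIP** (THEOREM-T.md §4, made discrete; hypothesis (B) of the signed counting lemma): in general position (pairwise
distinct slopes, no slope equal to `λ`, no third line through a crossing), if the window `[i, j₂]` contains a λ-type pair (witnessed by a λ-low tip
of a sub-window `[i, j₁]`) and its closed corridor is nonempty (witnessed by the vertex of a λ-low tip of a super-window `[i, j₃]`), then `[i, j₂]`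
has a λ-low tip — namely the λ-type pair of the window whose vertex has the LARGEST value of `y - λθ`.  Hence, for fixed `i`, the right ends `j`
of the windows `[i, j]` having a λ-low tip form an interval. [folklore] -/
theorem lowTip_between
    (hS : ∀ p q, S p q ↔
      ((¬ Even p ∧ ¬ Even q ∧ ((a p < lam ∧ lam < a q) ∨ (a q < lam ∧ lam < a p))) ∨
       (Odd (p + q) ∧ (if Even p then a q < a p else a p < a q) ∧ lam < (if Even p then a q else a p)) ∨
       (Odd (p + q) ∧ (if Even p then a p < a q else a q < a p) ∧ (if Even p then a q else a p) < lam)))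
    (n : ℕ) (hslope : ∀ p q, p ≤ n → q ≤ n → p ≠ q → a p ≠ a q) (hlam : ∀ p, p ≤ n → a p ≠ lam)
    (hgp : ∀ p q t, p ≤ n → q ≤ n → t ≤ n → p ≠ q → t ≠ p → t ≠ q →
      L a b t ((b q - b p) / (a p - a q)) ≠ L a b p ((b q - b p) / (a p - a q)))
    (i j₁ j₂ j₃ : ℕ) (h12 : j₁ ≤ j₂) (h23 : j₂ ≤ j₃) (h3n : j₃ ≤ n)
    (h1 : ∃ p q, i ≤ p ∧ p < q ∧ q ≤ j₁ ∧ S p q ∧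
      ∀ t, i ≤ t → t ≤ j₁ → t ≠ p → t ≠ q → 0 < gap t (L a b p ((b q - b p) / (a p - a q))) (L a b t ((b q - b p) / (a p - a q))))
    (h3 : ∃ p q, i ≤ p ∧ p < q ∧ q ≤ j₃ ∧ S p q ∧
      ∀ t, i ≤ t → t ≤ j₃ → t ≠ p → t ≠ q → 0 < gap t (L a b p ((b q - b p) / (a p - a q))) (L a b t ((b q - b p) / (a p - a q)))) :
    ∃ p q, i ≤ p ∧ p < q ∧ q ≤ j₂ ∧ S p q ∧
      ∀ t, i ≤ t → t ≤ j₂ → t ≠ p → t ≠ q → 0 < gap t (L a b p ((b q - b p) / (a p - a q))) (L a b t ((b q - b p) / (a p - a q))) := by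
  -- (a) the λ-type candidates of the window
  obtain ⟨p₁, q₁, hp₁, hpq₁, hq₁, hS₁, -⟩ := h1
  set Cand := ((Icc i j₂) ×ˢ (Icc i j₂)).filter (fun uv : ℕ × ℕ => uv.1 ≠ uv.2 ∧ S uv.1 uv.2) with hCand
  have hne : Cand.Nonempty := by
    refine ⟨(p₁, q₁), ?_⟩
    rw [hCand, mem_filter, mem_product, mem_Icc, mem_Icc]
    exact ⟨⟨⟨hp₁, by omega⟩, ⟨by omega, by omega⟩⟩, Nat.ne_of_lt hpq₁, hS₁⟩
  -- (b) a point of the closed corridor of `[i, j₂]`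
  obtain ⟨p₃, q₃, hp₃, hpq₃, hq₃, hS₃, hG₃⟩ := h3
  set τ₃ := (b q₃ - b p₃) / (a p₃ - a q₃) with hτ₃
  set y₃ := L a b p₃ τ₃ with hy₃
  have hA₃ : a p₃ ≠ a q₃ := slope_ne_of_lowType a lam S hS hS₃
  have hwit : ∀ t, i ≤ t → t ≤ j₂ → (Even t → y₃ ≤ L a b t τ₃) ∧ (¬ Even t → L a b t τ₃ ≤ y₃) := by
    intro t ht1 ht2
    by_cases htp : t = p₃
    · subst htp; exact ⟨fun _ => le_rfl, fun _ => le_rfl⟩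
    by_cases htq : t = q₃
    · subst htq
      have : L a b t τ₃ = y₃ := by rw [hy₃, hτ₃]; exact L_eq_L_crossAbs a b hA₃
      rw [this]; exact ⟨fun _ => le_rfl, fun _ => le_rfl⟩
    exact weak_of_gap_pos (hG₃ t ht1 (by omega) htp htq)
  -- (c) the candidate with the largest functional value
  obtain ⟨⟨u, v⟩, hmem, hmax⟩ := exists_max_image Cand
    (fun uv : ℕ × ℕ => L a b uv.1 ((b uv.2 - b uv.1) / (a uv.1 - a uv.2)) - lam * ((b uv.2 - b uv.1) / (a uv.1 - a uv.2))) hne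
  rw [hCand, mem_filter, mem_product, mem_Icc, mem_Icc] at hmem
  obtain ⟨⟨⟨hiu, huj⟩, ⟨hiv, hvj⟩⟩, huv, hSuv⟩ := hmem
  simp only at hiu huj hiv hvj huv hSuv hmax
  set τ₀ := (b v - b u) / (a u - a v) with hτ₀
  set y₀ := L a b u τ₀ with hy₀
  have hAuv : a u ≠ a v := slope_ne_of_lowType a lam S hS hSuv
  have hyv : L a b v τ₀ = y₀ := by rw [hy₀, hτ₀]; exact L_eq_L_crossAbs a b hAuv
  have hun : u ≤ n := by omega
  have hvn : v ≤ n := by omega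
  -- maximality over the λ-type pairs among three given indices of the window
  have hmax3 : ∀ t, i ≤ t → t ≤ j₂ → ∀ x y, (x = t ∨ x = u ∨ x = v) → (y = t ∨ y = u ∨ y = v) → S x y →
      L a b x ((b y - b x) / (a x - a y)) - lam * ((b y - b x) / (a x - a y)) ≤ L a b u τ₀ - lam * τ₀ := by
    intro t ht1 ht2 x y hx hy hSxy
    have hxy : x ≠ y := by
      intro h; have := slope_ne_of_lowType a lam S hS hSxy; rw [h] at this; exact this rfl
    have hmemxy : (x, y) ∈ Cand := by
      rw [hCand, mem_filter, mem_product, mem_Icc, mem_Icc]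
      refine ⟨⟨⟨?_, ?_⟩, ⟨?_, ?_⟩⟩, hxy, hSxy⟩
      · rcases hx with h | h | h <;> omega
      · rcases hx with h | h | h <;> omega
      · rcases hy with h | h | h <;> omega
      · rcases hy with h | h | h <;> omega
    exact hmax (x, y) hmemxy
  -- (d) every other line of the window is strictly on its correct side of the vertex
  have hgood : ∀ t, i ≤ t → t ≤ j₂ → t ≠ u → t ≠ v → 0 < gap t y₀ (L a b t τ₀) := by
    intro t ht1 ht2 htu htv
    have htn : t ≤ n := by omega
    by_contra hng
    have hne_val : L a b t τ₀ ≠ y₀ := by rw [hy₀, hτ₀]; exact hgp u v t hun hvn htn huv htu htv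
    have hbad : (Even t ∧ L a b t τ₀ < y₀) ∨ (¬ Even t ∧ y₀ < L a b t τ₀) := by
      unfold gap at hng
      by_cases hte : Even t
      · rw [if_pos hte, sub_pos, not_lt] at hng; exact Or.inl ⟨hte, lt_of_le_of_ne hng hne_val⟩
      · rw [if_neg hte, sub_pos, not_lt] at hng; exact Or.inr ⟨hte, lt_of_le_of_ne hng hne_val.symm⟩
    have hAtu : a t ≠ a u := hslope t u htn hun htu
    have hAtv : a t ≠ a v := hslope t v htn hvn htv
    have hlt : a t ≠ lam := hlam t htn
    have hm := hmax3 t ht1 ht2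
    have hw := hwit t ht1 ht2
    rcases (hS u v).mp hSuv with ⟨huo, hvo, hstr⟩ | ⟨hodd, hs, hl⟩ | ⟨hodd, hs, hl⟩
    · rcases hstr with ⟨h1', h2'⟩ | ⟨h1', h2'⟩
      · exact noBad_typeI a b lam S hS huo hvo h1' h2' hAtu hAtv hlt hbad hm
          ⟨τ₃, y₃, (hwit u hiu huj).2 huo, (hwit v hiv hvj).2 hvo, hw⟩
      · -- roles swapped: `o₁ = v`, `o₂ = u`
        have e0 : (b u - b v) / (a v - a u) = τ₀ := by rw [hτ₀]; exact crossAbs_symm a b v u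
        refine noBad_typeI a b lam S hS hvo huo h1' h2' hAtv hAtu hlt ?_ ?_
          ⟨τ₃, y₃, (hwit v hiv hvj).2 hvo, (hwit u hiu huj).2 huo, hw⟩
        · rw [e0, hyv]; exact hbad
        · intro x y hx hy hSxy
          rw [e0, hyv]
          exact hm x y (hx.imp_right Or.symm) (hy.imp_right Or.symm) hSxy
    · by_cases hue : Even u
      · rw [if_pos hue] at hs hl
        have hvo : ¬ Even v := fun h => by rw [Nat.odd_add'] at hodd; exact (Nat.not_even_iff_odd.mpr (hodd.mpr hue)) h
        refine noBad_typeII a b lam S hS hue hvo hs hl hAtu hAtv hlt ?_ ?_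
          ⟨τ₃, y₃, (hwit u hiu huj).1 hue, (hwit v hiv hvj).2 hvo, hw⟩
        · rw [hyv]; exact hbad
        · intro x y hx hy hSxy; rw [hyv]; exact hm x y hx hy hSxy
      · rw [if_neg hue] at hs hl
        have hve : Even v := by rw [Nat.odd_add] at hodd; exact hodd.mp (Nat.not_even_iff_odd.mp hue)
        have e0 : (b u - b v) / (a v - a u) = τ₀ := by rw [hτ₀]; exact crossAbs_symm a b v u
        refine noBad_typeII a b lam S hS hve hue hs hl hAtv hAtu hlt ?_ ?_
          ⟨τ₃, y₃, (hwit v hiv hvj).1 hve, (hwit u hiu huj).2 hue, hw⟩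
        · rw [e0]; exact hbad
        · intro x y hx hy hSxy; rw [e0]; exact hm x y (hx.imp_right Or.symm) (hy.imp_right Or.symm) hSxy
    · by_cases hue : Even u
      · rw [if_pos hue] at hs hl
        have hvo : ¬ Even v := fun h => by rw [Nat.odd_add'] at hodd; exact (Nat.not_even_iff_odd.mpr (hodd.mpr hue)) h
        refine noBad_typeIII a b lam S hS hue hvo hs hl hAtu hAtv hlt ?_ ?_
          ⟨τ₃, y₃, (hwit u hiu huj).1 hue, (hwit v hiv hvj).2 hvo, hw⟩
        · rw [hyv]; exact hbad
        · intro x y hx hy hSxy; rw [hyv]; exact hm x y hx hy hSxy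
      · rw [if_neg hue] at hs hl
        have hve : Even v := by rw [Nat.odd_add] at hodd; exact hodd.mp (Nat.not_even_iff_odd.mp hue)
        have e0 : (b u - b v) / (a v - a u) = τ₀ := by rw [hτ₀]; exact crossAbs_symm a b v u
        refine noBad_typeIII a b lam S hS hve hue hs hl hAtv hAtu hlt ?_ ?_
          ⟨τ₃, y₃, (hwit v hiv hvj).1 hve, (hwit u hiu huj).2 hue, hw⟩
        · rw [e0]; exact hbad
        · intro x y hx hy hSxy; rw [e0]; exact hm x y (hx.imp_right Or.symm) (hy.imp_right Or.symm) hSxy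
  -- (e) the tip, as an ordered pair
  rcases lt_or_gt_of_ne huv with hlt | hgt
  · exact ⟨u, v, hiu, hlt, hvj, hSuv, fun t h1 h2 h3 h4 => hgood t h1 h2 h3 h4⟩
  · refine ⟨v, u, hiv, hgt, huj, lowType_symm a lam S hS hSuv, fun t h1 h2 h3 h4 => ?_⟩
    have e0 : (b u - b v) / (a v - a u) = τ₀ := by rw [hτ₀]; exact crossAbs_symm a b v u
    rw [e0, hyv]; exact hgood t h1 h2 h4 h3

end LowTips

end

end StaticPathFold

end Summit.ValiantsHypothesis.ValiantsHypothesis.Theorems.KPlusLogSqLaw
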